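import Summits.Parity.GeneralizedHardyLittlewood.Theses.LiouvilleMAD
import Summits.Parity.GeneralizedHardyLittlewood.Theorems.LiouvilleMADCosetDecorrelationStubNormalForm

/-!
# `CosetDecorrelation` (stmt-Parity-13317): exact degenerations and load-bearing structure

Negative-side lemmas for the crux `LiouvilleMAD.CosetDecorrelation` (route LiouvilleMAD, rank 2; cdisprove seat,
cycle 1), landed from the crux work file `Cruxes/CosetDecorrelation/Disproof.lean` (§0–§2 there) so that
skeletons, ideators and provers can import them.  Nothing here asserts the crux or its negation.

Notation: `u n c m = λ(mn+c)` (real, junk `0` below the shift), `pairs M j = {(m,m') ∈ (M,2M]² : m ≡ m' (mod j)}`,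
`cosetW f g M j = Σ_{pairs} f(m) g(m')`, `T c n n' M j = cosetW (u n c) (u n' c) M j` = the crux's sum
(`crux_iff`, `Iff.rfl`).

DEGENERATIONS (why `c ≠ 0` and `n ≠ n'` are in the statement, and what the aligned sub-family is):
`aligned_shift` (`c = n·a = n'·b` ⟹ `T = λ(n)λ(n')·cosetW λ(·+a) λ(·+b)`: autocorrelation of the class
profile of `λ` at the bounded lag `a − b` — every multiplicative alignment along a coset row `m' = m + tj`
needs `nn'tj ∣ c(n'−n)`, impossible once `j > |c|` since `c` is quantified outside `M`), `shift_zero` /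
`abs_shift_zero` (`c = 0`: `|T| = V_j(M)`, the class variance of `λ`, independent of the dilations),
`selfCoset_nonneg`, `sq_sum_div_le_selfCoset` (a self-coset sum is `≥ (Σ f)²/j ≥ 0`),
`equalDilations_nonneg` (`n = n'`), `dilation_zero` (`n = 0`); the dropped-hypothesis variants
`WithoutShiftNeZero`, `WithoutDilationsNe` reduce to the single-modulus variance bounds `VarianceBound`,
`ProgressionVarianceBound` — false in the random model (`V ≈ M`, kit job j016671), but a Lean refutation would
need an anti-concentration lower bound `V ≥ M^{1−o(1)}` for `λ` in classes mod `j ≍ √M` that nobody has.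
[folklore]
-/

namespace Summit.Parity.GeneralizedHardyLittlewood.Theorems.CosetDecorrelation.Negative

open Summit.Parity.GeneralizedHardyLittlewood.Theses.LiouvilleMAD
open Summit.Parity.GeneralizedHardyLittlewood.Theorems.CosetDecorrelation.FareyLevelMeanCoupling
  (normalForm_coset_eq_classInner normalForm_sum_classSum)
open Finset

/-! ## §0 The object and the read-back -/

/-- `u n c m = λ(mn+c)` as a real number (junk value `0` when `mn + c ≤ 0`, since `λ 0 = 0`). -/
noncomputable def u (n : ℕ) (c : ℤ) (m : ℕ) : ℝ :=
  (ArithmeticFunction.liouville (Int.toNat ((m : ℤ) * n + c)) : ℝ)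

/-- `λ` itself as a real sequence. -/
noncomputable def lam (m : ℕ) : ℝ := (ArithmeticFunction.liouville m : ℝ)

/-- The coset `P_j(M) = {(m,m') ∈ (M,2M]² : m ≡ m' (mod j)}`. -/
def pairs (M j : ℕ) : Finset (ℕ × ℕ) :=
  (Ioc M (2 * M) ×ˢ Ioc M (2 * M)).filter (fun p : ℕ × ℕ => p.1 ≡ p.2 [MOD j])

/-- General-weight coset sum `Σ_{(m,m') ∈ P_j(M)} f(m) g(m')`. -/
noncomputable def cosetW (f g : ℕ → ℝ) (M j : ℕ) : ℝ := ∑ p ∈ pairs M j, f p.1 * g p.2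

/-- The crux's sum `T_j(n,n';c,M)`. -/
noncomputable def T (c : ℤ) (n n' M j : ℕ) : ℝ := cosetW (u n c) (u n' c) M j

/-- READ-BACK: the crux is literally the uniform bound on `T` (definitional unfolding). -/
theorem crux_iff :
    CosetDecorrelation ↔
      ∀ c : ℤ, c ≠ 0 → ∃ ϑ : ℝ, ϑ < 1 / 4 ∧ ∃ C : ℝ, ∀ M n n' j : ℕ, 1 ≤ n → 1 ≤ n' → n ≠ n' →
        n ≤ 2 * M → n' ≤ 2 * M → Nat.sqrt M + 1 ≤ j → j < 2 * (Nat.sqrt M + 1) →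
          |T c n n' M j| ≤ C * (M : ℝ) ^ (3 / 4 + ϑ) :=
  Iff.rfl

/-- Class inner product (lead's landed `normalForm_coset_eq_classInner`, restated for `cosetW`):
`cosetW f g M j = Σ_{a<j} A_f(a) A_g(a)`. -/
theorem cosetW_eq_classInner (f g : ℕ → ℝ) (M j : ℕ) (hj : 1 ≤ j) :
    cosetW f g M j = ∑ a ∈ range j,
      (∑ m ∈ (Ioc M (2 * M)).filter (fun m => m ≡ a [MOD j]), f m) *
        (∑ m ∈ (Ioc M (2 * M)).filter (fun m => m ≡ a [MOD j]), g m) :=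
  normalForm_coset_eq_classInner f g M j hj

/-! ## §1 Conventions -/

/-- `λ(0) = 0` (Mathlib's `ArithmeticFunction` convention). -/
theorem liouville_zero : ArithmeticFunction.liouville 0 = 0 := by simp

/-- Below the shift (`mn + c ≤ 0`) the summand is the junk value `0`, not `±1`. -/
theorem u_of_nonpos {n : ℕ} {c : ℤ} {m : ℕ} (h : (m : ℤ) * n + c ≤ 0) : u n c m = 0 := by
  unfold u
  rw [Int.toNat_of_nonpos h]
  simp

/-- `|λ(mn+c)| ≤ 1` in the real spelling (junk value included). -/
theorem abs_u_le_one (n : ℕ) (c : ℤ) (m : ℕ) : |u n c m| ≤ 1 := by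
  unfold u
  rcases eq_or_ne (Int.toNat ((m : ℤ) * n + c)) 0 with h | h
  · rw [h]; simp
  · rw [ArithmeticFunction.liouville_apply h]; push_cast
    rw [abs_pow, abs_neg, abs_one, one_pow]

/-! ## §2 Load-bearing analysis: exact degenerations -/

/-- `Int.toNat` commutes with multiplication by a natural number (also in the junk range). -/
theorem toNat_natCast_mul (n : ℕ) (x : ℤ) : Int.toNat ((n : ℤ) * x) = n * Int.toNat x := by
  rcases le_or_gt 0 x with hx | hx
  · lift x to ℕ using hx
    rw [Int.toNat_natCast, ← Nat.cast_mul, Int.toNat_natCast]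
  · rw [Int.toNat_of_nonpos hx.le, mul_zero,
      Int.toNat_of_nonpos (mul_nonpos_of_nonneg_of_nonpos (by positivity) hx.le)]

/-- MULTIPLICATIVE PULL-OUT: if `c = n·a` then `λ(mn + c) = λ(n)·λ(m + a)` for all `m`
(complete multiplicativity; consistent in the junk range since both sides vanish there). -/
theorem u_of_dvd (n : ℕ) (a : ℤ) (m : ℕ) :
    u n (n * a) m = (ArithmeticFunction.liouville n : ℝ) *
      (ArithmeticFunction.liouville (Int.toNat ((m : ℤ) + a)) : ℝ) := by
  unfold u
  rw [show (m : ℤ) * n + n * a = (n : ℤ) * ((m : ℤ) + a) by ring, toNat_natCast_mul,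
    ArithmeticFunction.liouville_apply_mul]
  push_cast; ring

/-- (iv) ALIGNED SHIFTS.  If `c = n·a = n'·b` then
`T_j(n,n';c) = λ(n)λ(n') · Σ_{m≡m' (j)} λ(m+a) λ(m'+b)`: the coset sum of `λ` against ITSELF with the two
windows translated by `a` and `b` — a class-profile autocorrelation at the bounded lag `a − b`. -/
theorem aligned_shift (n n' : ℕ) (a b c : ℤ) (ha : c = n * a) (hb : c = n' * b) (M j : ℕ) :
    T c n n' M j = (ArithmeticFunction.liouville n : ℝ) * (ArithmeticFunction.liouville n' : ℝ) *
      cosetW (fun m => (ArithmeticFunction.liouville (Int.toNat ((m : ℤ) + a)) : ℝ))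
        (fun m => (ArithmeticFunction.liouville (Int.toNat ((m : ℤ) + b)) : ℝ)) M j := by
  unfold T cosetW
  rw [mul_sum]
  refine sum_congr rfl fun p _ => ?_
  rw [show u n c p.1 = u n (n * a) p.1 by rw [← ha], show u n' c p.2 = u n' (n' * b) p.2 by rw [← hb],
    u_of_dvd, u_of_dvd]
  ring

/-- (i) SHIFT ZERO.  `T_j(n,n';0) = λ(n)λ(n') · Σ_{m ≡ m' (j)} λ(m)λ(m')` — the sign `λ(nn')` times a
quantity independent of `(n,n')`. -/
theorem shift_zero (n n' M j : ℕ) :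
    T 0 n n' M j = (ArithmeticFunction.liouville n : ℝ) * (ArithmeticFunction.liouville n' : ℝ) *
      cosetW lam lam M j := by
  rw [aligned_shift n n' 0 0 0 (by simp) (by simp) M j]
  congr 1

/-- A coset sum of a sequence against ITSELF is a sum of squares of class sums: nonnegative. -/
theorem selfCoset_nonneg (f : ℕ → ℝ) (M j : ℕ) (hj : 1 ≤ j) : 0 ≤ cosetW f f M j := by
  rw [cosetW_eq_classInner f f M j hj]
  exact sum_nonneg fun a _ => mul_self_nonneg _

/-- … and it dominates the level-one term: `cosetW f f ≥ (Σ f)²/j` (mean coupling with `f = g`). -/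
theorem sq_sum_div_le_selfCoset (f : ℕ → ℝ) (M j : ℕ) (hj : 1 ≤ j) :
    (∑ m ∈ Ioc M (2 * M), f m) ^ 2 / j ≤ cosetW f f M j := by
  rw [cosetW_eq_classInner f f M j hj]
  have hjpos : (0 : ℝ) < j := by exact_mod_cast hj
  rw [div_le_iff₀ hjpos, ← normalForm_sum_classSum f M j hj]
  have := sum_mul_sq_le_sq_mul_sq (range j) (fun _ => (1 : ℝ))
    (fun a => ∑ m ∈ (Ioc M (2 * M)).filter (fun m => m ≡ a [MOD j]), f m)
  simp only [one_pow, sum_const, card_range, nsmul_eq_mul, mul_one, one_mul] at this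
  calc (∑ a ∈ range j, ∑ m ∈ (Ioc M (2 * M)).filter (fun m => m ≡ a [MOD j]), f m) ^ 2
      ≤ (j : ℝ) * ∑ a ∈ range j, (∑ m ∈ (Ioc M (2 * M)).filter (fun m => m ≡ a [MOD j]), f m) ^ 2 := this
    _ = (∑ a ∈ range j, (∑ m ∈ (Ioc M (2 * M)).filter (fun m => m ≡ a [MOD j]), f m) *
          (∑ m ∈ (Ioc M (2 * M)).filter (fun m => m ≡ a [MOD j]), f m)) * j := by
        rw [mul_comm]; simp only [sq]

/-- (i′) At `c = 0` the ABSOLUTE VALUE of the crux's sum is the variance `V_j(M) = Σ_{m≡m'} λ(m)λ(m')`,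
the same for every pair of nonzero dilations. -/
theorem abs_shift_zero {n n' : ℕ} (hn : 1 ≤ n) (hn' : 1 ≤ n') (M j : ℕ) (hj : 1 ≤ j) :
    |T 0 n n' M j| = cosetW lam lam M j := by
  rw [shift_zero, abs_mul, abs_mul, abs_of_nonneg (selfCoset_nonneg lam M j hj)]
  have h1 : |(ArithmeticFunction.liouville n : ℝ)| = 1 := by
    rw [ArithmeticFunction.liouville_apply (by omega)]; push_cast
    rw [abs_pow, abs_neg, abs_one, one_pow]
  have h2 : |(ArithmeticFunction.liouville n' : ℝ)| = 1 := by
    rw [ArithmeticFunction.liouville_apply (by omega)]; push_cast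
    rw [abs_pow, abs_neg, abs_one, one_pow]
  rw [h1, h2, one_mul, one_mul]

/-- (ii) EQUAL DILATIONS.  `T_j(n,n;c) = Σ_a A_n(a)² ≥ (Σ_m λ(mn+c))²/j ≥ 0`. -/
theorem equalDilations_nonneg (c : ℤ) (n M j : ℕ) (hj : 1 ≤ j) : 0 ≤ T c n n M j :=
  selfCoset_nonneg _ M j hj

/-- `T_j(n,n;c) ≥ S(n)²/j`: the equal-dilation sum dominates its own level-one term. -/
theorem sq_mean_le_equalDilations (c : ℤ) (n M j : ℕ) (hj : 1 ≤ j) :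
    (∑ m ∈ Ioc M (2 * M), u n c m) ^ 2 / j ≤ T c n n M j :=
  sq_sum_div_le_selfCoset _ M j hj

/-- (iii) DILATION ZERO (drop `1 ≤ n`).  `T_j(0,n';c) = λ(c) · Σ_{(m,m') ∈ P_j} λ(m'n'+c)`: the first
factor is the constant `λ(c)` and the sum is `Σ_{m'} N_j(m') λ(m'n'+c)`, `N_j(m') = #{m ≡ m' (j)} ≈ M/j`. -/
theorem dilation_zero (c : ℤ) (n' M j : ℕ) :
    T c 0 n' M j = (ArithmeticFunction.liouville (Int.toNat c) : ℝ) * ∑ p ∈ pairs M j, u n' c p.2 := by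
  unfold T cosetW
  rw [mul_sum]
  refine sum_congr rfl fun p _ => ?_
  simp [u]

/-! ### The dropped-hypothesis variants, by name, and what they reduce to -/

/-- The crux with `c ≠ 0` dropped. -/
def WithoutShiftNeZero : Prop :=
  ∀ c : ℤ, ∃ ϑ : ℝ, ϑ < 1 / 4 ∧ ∃ C : ℝ, ∀ M n n' j : ℕ, 1 ≤ n → 1 ≤ n' → n ≠ n' →
    n ≤ 2 * M → n' ≤ 2 * M → Nat.sqrt M + 1 ≤ j → j < 2 * (Nat.sqrt M + 1) →
      |T c n n' M j| ≤ C * (M : ℝ) ^ (3 / 4 + ϑ)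

/-- The crux with `n ≠ n'` dropped. -/
def WithoutDilationsNe : Prop :=
  ∀ c : ℤ, c ≠ 0 → ∃ ϑ : ℝ, ϑ < 1 / 4 ∧ ∃ C : ℝ, ∀ M n n' j : ℕ, 1 ≤ n → 1 ≤ n' →
    n ≤ 2 * M → n' ≤ 2 * M → Nat.sqrt M + 1 ≤ j → j < 2 * (Nat.sqrt M + 1) →
      |T c n n' M j| ≤ C * (M : ℝ) ^ (3 / 4 + ϑ)

/-- Single-modulus variance bound for `λ` in the classes mod `j ≍ √M` of a dyadic block:
`V_j(M) = Σ_{a mod j} (Σ_{m ∈ (M,2M], m≡a} λ(m))² ≤ C·M^{3/4+ϑ}` for some `ϑ < 1/4`.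
FALSE in the random model (`V_j(M) = M + off-diagonal ≈ M`, numerics §7) — a power ANTI-concentration
statement nobody can prove: this is exactly why `c ≠ 0` cannot be certified load-bearing in Lean. -/
def VarianceBound : Prop :=
  ∃ ϑ : ℝ, ϑ < 1 / 4 ∧ ∃ C : ℝ, ∀ M j : ℕ, 1 ≤ M → Nat.sqrt M + 1 ≤ j → j < 2 * (Nat.sqrt M + 1) →
    cosetW lam lam M j ≤ C * (M : ℝ) ^ (3 / 4 + ϑ)

/-- `c ≠ 0` dropped ⟹ the variance bound (take `c = 0`, `(n,n') = (1,2)`). -/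
theorem varianceBound_of_withoutShiftNeZero (h : WithoutShiftNeZero) : VarianceBound := by
  obtain ⟨ϑ, hϑ, C, hC⟩ := h 0
  refine ⟨ϑ, hϑ, C, fun M j hM hj1 hj2 => ?_⟩
  have := hC M 1 2 j le_rfl (by norm_num) (by norm_num) (by omega) (by omega) hj1 hj2
  rwa [abs_shift_zero le_rfl (by norm_num) M j (by omega)] at this

/-- Variance of the progression profile: `V_n(c;M,j) = T_j(n,n;c) ≤ C M^{3/4+ϑ}` — the `n = n'` variant
reduces to this, equally false in the random model (`V_n/M ≈ 1`, §7) and equally unprovable. -/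
def ProgressionVarianceBound : Prop :=
  ∀ c : ℤ, c ≠ 0 → ∃ ϑ : ℝ, ϑ < 1 / 4 ∧ ∃ C : ℝ, ∀ M n j : ℕ, 1 ≤ n → n ≤ 2 * M →
    Nat.sqrt M + 1 ≤ j → j < 2 * (Nat.sqrt M + 1) → T c n n M j ≤ C * (M : ℝ) ^ (3 / 4 + ϑ)

/-- `n ≠ n'` dropped ⟹ the progression-variance bound (take `n = n'`). -/
theorem progressionVarianceBound_of_withoutDilationsNe (h : WithoutDilationsNe) :
    ProgressionVarianceBound := by
  intro c hc
  obtain ⟨ϑ, hϑ, C, hC⟩ := h c hc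
  refine ⟨ϑ, hϑ, C, fun M n j hn hnM hj1 hj2 => ?_⟩
  exact (le_abs_self _).trans (hC M n n j hn hn hnM hnM hj1 hj2)


end Summit.Parity.GeneralizedHardyLittlewood.Theorems.CosetDecorrelation.Negative
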